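import Summits.QuantumFields.YangMills.Theorems.LuscherReductionDressedRitzPolyakovLiftTransplantOctahedral
import Summits.QuantumFields.YangMills.Theorems.LuscherReductionDressedRitzPolyakovLiftTransplantHyperoctLR
import HarnessLib

/-!
# Line «polyakovlift» r7 on crux `DressedRitz` (stmt-QuantumFields-20205): the statics stub text `StaticsForL (TransplantBasisLR k)` from a FLAT
# symmetry certificate on the AL1 families of `𝔥` — signs, `B₃` twirls, or axis multiplets, pair by pair

Fleet-service module of seat ym-infvol-p1 g7 — the user-facing form of this seat's S-STAT″ (o2)-by-symmetry lineage.  ★★ `staticsForLR_of_flatCert k`: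
if for EVERY AL1 family `f` of the matrix model at level `k` with `f_0 > 0` and every excited pair `i ≠ l` ONE of the following flat certificates holds —
(A) opposite signs under a hyperoctahedral generator (transposition / axis reflection / parity), (B) a `B₃`-twirl identity (an inverse-pairing-symmetric
weight `w` on the 48 signed axis permutations whose flat twirl fixes `f_{i+1}` and kills `f_{l+1}`, or vice versa — Schur row projectors), or (C) an axis
multiplet `E` with `f_{i+1} = Σ p_a E_a`, `f_{l+1} = Σ q_a E_a`, `p ⊥ q` — then `StaticsForL (TransplantBasisLR k)`, the r7 text of `stub_liftStatics` at
level `k` (via `staticsForLR_of_separationCert` and the constructors of `…TransplantParity/Reflect/Multiplet/Octahedral`).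

WHAT THIS LEAVES of `stub_liftStatics : ∀ k, StaticsForL (TransplantBasisLR k)`: levels `k ≤ 1` are closed outright (`staticsForLR_of_le_one`); for `k ≥ 2`
the hypothesis of this theorem is ONE-type spectral input on `𝔥` (which isotypes / signs / multiplets the `k+1` lowest AL1 states carry — known numerically
[cite: LuscherMunster1984, §4], not proved), and it FAILS by nature for two states in the same row of equivalent `B₃`-irreducibles (e.g. two `A₁⁺` radial
excitations), where (o2) is renormalisation-group content (near-orthogonality of same-row transplants), not symmetry.
HONEST FRAMING: bookkeeping on the conditional femto rung R2b1; 0/4 stubs of the line closed by this file; not infinite volume, not a gap, not Clay.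
References: M. Lüscher, NPB 219 (1983) 233 [cite: Luscher1983, §2–§3]; M. Lüscher, G. Münster, NPB 232 (1984) 445 [cite: LuscherMunster1984, §4].
-/

set_option autoImplicit false

noncomputable section

open MeasureTheory Filter Topology Real
open Literature.MathematicalPhysics.QuantumFieldTheory (GaugeConfig Site gaugeTransform configPerm)
open Literature.Analysis.OperatorTheory.YMMatrixModel
open scoped BigOperators

namespace Summit.QuantumFields.YangMills.Theorems.FemtoTransferGap.PolyakovLift

open Summit.QuantumFields.YangMills.Theorems.FemtoTransferGap

/-- ★★ **The r7 statics stub text at level `k` from a flat symmetry certificate, pair by pair** — (A) hyperoctahedral signs, (B) a `B₃`-twirl identity, or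
(C) an axis multiplet with orthogonal coefficient vectors. [cite: Luscher1983, §2–§3] [cite: LuscherMunster1984, §4] [cite: LuscherWolff1990] -/
theorem staticsForLR_of_flatCert (k : ℕ)
    (hcert : ∀ f : Fin (k + 1) → ZM → ℝ, IsEigenFamily k f → (∀ x, 0 < f 0 x) → ∀ i l : Fin k, i ≠ l →
      -- (A) opposite signs under one hyperoctahedral generator
      ((∃ a b : Fin 3,
        ((∀ y, f i.succ (LinearIsometryEquiv.piLpCongrLeft 2 ℝ ℝ ((Equiv.swap a b).prodCongr (Equiv.refl (Fin 3))) y) = f i.succ y) ∧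
            (∀ y, f l.succ (LinearIsometryEquiv.piLpCongrLeft 2 ℝ ℝ ((Equiv.swap a b).prodCongr (Equiv.refl (Fin 3))) y) = -f l.succ y)) ∨
          ((∀ y, f l.succ (LinearIsometryEquiv.piLpCongrLeft 2 ℝ ℝ ((Equiv.swap a b).prodCongr (Equiv.refl (Fin 3))) y) = f l.succ y) ∧
            (∀ y, f i.succ (LinearIsometryEquiv.piLpCongrLeft 2 ℝ ℝ ((Equiv.swap a b).prodCongr (Equiv.refl (Fin 3))) y) = -f i.succ y))) ∨
      (∃ kx : Fin 3,
        ((∀ y, f i.succ (LinearIsometryEquiv.piLpCongrRight 2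
              (fun q : Fin 3 × Fin 3 => if q.1 = kx then LinearIsometryEquiv.neg ℝ (E := ℝ) else LinearIsometryEquiv.refl ℝ ℝ) y) = f i.succ y) ∧
            (∀ y, f l.succ (LinearIsometryEquiv.piLpCongrRight 2
              (fun q : Fin 3 × Fin 3 => if q.1 = kx then LinearIsometryEquiv.neg ℝ (E := ℝ) else LinearIsometryEquiv.refl ℝ ℝ) y) = -f l.succ y)) ∨
          ((∀ y, f l.succ (LinearIsometryEquiv.piLpCongrRight 2
              (fun q : Fin 3 × Fin 3 => if q.1 = kx then LinearIsometryEquiv.neg ℝ (E := ℝ) else LinearIsometryEquiv.refl ℝ ℝ) y) = f l.succ y) ∧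
            (∀ y, f i.succ (LinearIsometryEquiv.piLpCongrRight 2
              (fun q : Fin 3 × Fin 3 => if q.1 = kx then LinearIsometryEquiv.neg ℝ (E := ℝ) else LinearIsometryEquiv.refl ℝ ℝ) y) = -f i.succ y))) ∨
      (((∀ y, f i.succ (-y) = f i.succ y) ∧ (∀ y, f l.succ (-y) = -f l.succ y)) ∨
        ((∀ y, f l.succ (-y) = f l.succ y) ∧ (∀ y, f i.succ (-y) = -f i.succ y)))) ∨
      -- (B) a `B₃`-twirl identity
      (∃ w : (Fin 3 → Bool) × Equiv.Perm (Fin 3) → ℝ,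
        (∀ g : (Fin 3 → Bool) × Equiv.Perm (Fin 3), w ((g.1 ∘ ⇑g.2 : Fin 3 → Bool), g.2⁻¹) = w g) ∧
        (((∀ y, ∑ g : (Fin 3 → Bool) × Equiv.Perm (Fin 3), w g * f i.succ (LinearIsometryEquiv.piLpCongrRight 2
              (fun q : Fin 3 × Fin 3 => if g.1 q.1 = true then LinearIsometryEquiv.neg ℝ (E := ℝ) else LinearIsometryEquiv.refl ℝ ℝ)
              (LinearIsometryEquiv.piLpCongrLeft 2 ℝ ℝ (g.2.prodCongr (Equiv.refl (Fin 3))) y)) = f i.succ y) ∧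
            (∀ y, ∑ g : (Fin 3 → Bool) × Equiv.Perm (Fin 3), w g * f l.succ (LinearIsometryEquiv.piLpCongrRight 2
              (fun q : Fin 3 × Fin 3 => if g.1 q.1 = true then LinearIsometryEquiv.neg ℝ (E := ℝ) else LinearIsometryEquiv.refl ℝ ℝ)
              (LinearIsometryEquiv.piLpCongrLeft 2 ℝ ℝ (g.2.prodCongr (Equiv.refl (Fin 3))) y)) = 0)) ∨
          ((∀ y, ∑ g : (Fin 3 → Bool) × Equiv.Perm (Fin 3), w g * f l.succ (LinearIsometryEquiv.piLpCongrRight 2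
              (fun q : Fin 3 × Fin 3 => if g.1 q.1 = true then LinearIsometryEquiv.neg ℝ (E := ℝ) else LinearIsometryEquiv.refl ℝ ℝ)
              (LinearIsometryEquiv.piLpCongrLeft 2 ℝ ℝ (g.2.prodCongr (Equiv.refl (Fin 3))) y)) = f l.succ y) ∧
            (∀ y, ∑ g : (Fin 3 → Bool) × Equiv.Perm (Fin 3), w g * f i.succ (LinearIsometryEquiv.piLpCongrRight 2
              (fun q : Fin 3 × Fin 3 => if g.1 q.1 = true then LinearIsometryEquiv.neg ℝ (E := ℝ) else LinearIsometryEquiv.refl ℝ ℝ)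
              (LinearIsometryEquiv.piLpCongrLeft 2 ℝ ℝ (g.2.prodCongr (Equiv.refl (Fin 3))) y)) = 0)))) ∨
      -- (C) an axis multiplet with orthogonal coefficient vectors
      (∃ (n : ℕ) (E : Fin n → ZM → ℝ) (a₀ : Fin n) (κ : Fin n → Fin n → Fin 3) (perm : Fin n → Equiv.Perm (Fin 3)) (p q : Fin n → ℝ),
        (∀ a, Continuous (E a)) ∧ (∀ a, IsGaugeInv (E a)) ∧
        (∀ a b, a ≠ b →
          (∀ y, E a (LinearIsometryEquiv.piLpCongrRight 2
              (fun q : Fin 3 × Fin 3 => if q.1 = κ a b then LinearIsometryEquiv.neg ℝ (E := ℝ) else LinearIsometryEquiv.refl ℝ ℝ) y) = E a y) ∧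
          (∀ y, E b (LinearIsometryEquiv.piLpCongrRight 2
              (fun q : Fin 3 × Fin 3 => if q.1 = κ a b then LinearIsometryEquiv.neg ℝ (E := ℝ) else LinearIsometryEquiv.refl ℝ ℝ) y) = -E b y)) ∧
        (∀ a, ∃ ε : ℝ, ε ^ 2 = 1 ∧
          ∀ y, E a₀ (LinearIsometryEquiv.piLpCongrLeft 2 ℝ ℝ ((perm a).prodCongr (Equiv.refl (Fin 3))) y) = ε * E a y) ∧
        (∑ a, p a * q a = 0) ∧ (∀ y, f i.succ y = ∑ a, p a * E a y) ∧ (∀ y, f l.succ y = ∑ a, q a * E a y))) :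
    StaticsForL (TransplantBasisLR k) := by
  refine staticsForLR_of_separationCert k fun L Λ g hbasis i l hil => ?_
  obtain ⟨f, R, hf, hpos, hR1, -, -, hg⟩ := hbasis
  rw [hg i, hg l]
  rcases hcert f hf hpos i l hil with (⟨a, b, hab⟩ | ⟨kx, hk⟩ | hpar) | ⟨w, hw, havg⟩ | ⟨n, E, a₀, κ, perm, p, q, hEc, hEinv, hrefl, hperm, hpq, hfi, hfl⟩
  · exact pairSeparated_transplantObsL_swap L Λ R hf hpos a b hab
  · exact pairSeparated_transplantObsL_reflect L Λ R hf hpos kx hk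
  · exact pairSeparated_transplantObsL_parity L Λ R hf hpos hpar
  · exact pairSeparated_transplantObsL_of_octTwirl L Λ R hf hpos w hw havg
  · exact pairSeparated_transplantObsL_of_axisMultiplet L (lt_of_lt_of_le one_pos hR1) hf hpos E hEc hEinv a₀ κ perm hrefl hperm p q hpq hfi hfl

end Summit.QuantumFields.YangMills.Theorems.FemtoTransferGap.PolyakovLift

end
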